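import Summits.RiemannHypothesis.RiemannHypothesis.Theorems.GroundBartaEvenWinsBeyondArchDeflationWeightedRitz
import Summits.RiemannHypothesis.RiemannHypothesis.Theorems.GroundBartaEvenWinsBeyondArchDeflationSliverEdge
import Summits.RiemannHypothesis.RiemannHypothesis.Theorems.GroundBartaEvenWinsBeyondArchDeflationCertBridge
import Summits.RiemannHypothesis.RiemannHypothesis.Theorems.GroundBartaEvenWinsBeyondArchDeflationCrossGram
import HarnessLib

/-!
# RiemannHypothesis / GroundBarta — rung 4 (`EvenWinsBeyondArch`, stmt-RiemannHypothesis-18807 / 18085):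
# the deflated Temple L-side, bridge from a two-prime certificate with the EDGE-ONLY sliver (weighted criterion)

Helper file (`--supports stmt-RiemannHypothesis-18085`), RH-free, no definitions, no named facts.  Prover A (gen 4 of
unit `sr-gb-rung-a`).

Weighted analogue of `dt_weilOddGroundEnergy_ge_of_deflCert` (file …CertBridge): the rank-one augmented two-prime
certificate `β₂₃‖g‖² ≤ E₂₃(g) + Σ μ_r |Σ ĉ M(g)|²` on the odd tests of `[-a₀, a₀]` and the edge form of the three-prime
sliver `E₂₃(g) − (log 2)/2 ∫_{|u| ≥ y₁}|g|² ≤ Re Q(g)` (`y₁ ≤ log 4 − c`) give the POINTWISE complement level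
`β₂₃ − (log 2)/2 · 𝟙_{|u| ≥ y₁}`; the weighted deflated Temple criterion (`dt_weilOddGroundEnergy_ge_of_ritz_w`) then yields
`λ ≤ ε_od(c)` from `A − λG − R_w ⪰ 0`, where the residual Gram matrix is weighted by
`w = 1/(β₂₃ − λ)` on `|y| < y₁` and `w = 1/(β₂₃ − κ₂ − λ)` on `|y| ≥ y₁`, `κ₂ ≥ (log 2)/2` any (rational) majorant so that
all weights are rational.

* `dt_integral_piecewise_mul` — `∫ (E.piecewise a b) f = b ∫ f + (a − b) ∫ 𝟙_E f` (how prover B's interior/edge partial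
  residual Gram matrices enter); `dt_wpairing_comm`, `dt_abs_wcross_le_pw` — symmetry and the Cauchy–Schwarz box for WEIGHTED
  cross integrals with a two-valued weight (the uncertified pairs of the per-cell files);
* **`dt_weilOddGroundEnergy_ge_of_deflCert_w`**.
-/

set_option linter.dupNamespace false

noncomputable section

open MeasureTheory Set Filter
open scoped Topology ComplexConjugate BigOperators

namespace Summit.RiemannHypothesis.RiemannHypothesis.Theorems.EvenWinsBeyondArch

open Literature.NumberTheory.LFunctions
open Summit.RiemannHypothesis.RiemannHypothesis.Theorems.OddSector (weilDirichletEnergy₂ weilPoleForm₂)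

/-- `∫ (E.piecewise a b)·f = b ∫ f + (a − b) ∫ 𝟙_E f` for integrable `f` and measurable `E`. [folklore] -/
theorem dt_integral_piecewise_mul {E : Set ℝ} [DecidablePred (· ∈ E)] (hE : MeasurableSet E) (a b : ℝ) {f : ℝ → ℝ}
    (hf : Integrable f) :
    ∫ y, E.piecewise (fun _ ↦ a) (fun _ ↦ b) y * f y = b * (∫ y, f y) + (a - b) * ∫ y, E.indicator f y := by
  have hpt : ∀ y, E.piecewise (fun _ ↦ a) (fun _ ↦ b) y * f y = b * f y + (a - b) * E.indicator f y := by
    intro y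
    by_cases hy : y ∈ E
    · rw [Set.piecewise_eq_of_mem _ _ _ hy, Set.indicator_of_mem hy]; ring
    · rw [Set.piecewise_eq_of_notMem _ _ _ hy, Set.indicator_of_notMem hy]; ring
  simp_rw [hpt]
  rw [integral_add (hf.const_mul b) ((hf.indicator hE).const_mul _), integral_const_mul, integral_const_mul]


/-- `‖√w · z‖² = w ‖z‖²` for `w ≥ 0`. [folklore] -/
theorem dt_norm_sq_sqrt_mul {w : ℝ} (hw : 0 ≤ w) (z : ℂ) : ‖((Real.sqrt w : ℝ) : ℂ) * z‖ ^ 2 = w * ‖z‖ ^ 2 := by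
  rw [norm_mul, Complex.norm_real, Real.norm_of_nonneg (Real.sqrt_nonneg _), mul_pow, Real.sq_sqrt hw]

/-- Symmetry of the weighted real pairing. [folklore] -/
theorem dt_wpairing_comm (w : ℝ → ℝ) (f g : ℝ → ℂ) :
    ∫ y, w y * (f y * conj (g y)).re = ∫ y, w y * (g y * conj (f y)).re := by
  congr 1 with y
  rw [← Complex.conj_re (f y * conj (g y)), map_mul, Complex.conj_conj, mul_comm (conj (f y))]

/-- **Cauchy–Schwarz box for a weighted cross integral** with a two-valued weight `w = E.piecewise a b` (`a, b ≥ 0`):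
`|∫ w Re(f ḡ)| ≤ (t·sf + sg/t)/2` whenever `∫ w‖f‖² ≤ sf`, `∫ w‖g‖² ≤ sg`, `t > 0` (apply `dt_abs_cross_le` to `√w f`, `√w g`). [folklore] -/
theorem dt_abs_wcross_le_pw {E : Set ℝ} [DecidablePred (· ∈ E)] (hE : MeasurableSet E) {a b : ℝ} (ha : 0 ≤ a) (hb : 0 ≤ b)
    {f g : ℝ → ℂ}
    (hf : MemLp f 2) (hg : MemLp g 2) {sf sg t : ℝ} (ht : 0 < t)
    (hsf : ∫ y, E.piecewise (fun _ ↦ a) (fun _ ↦ b) y * ‖f y‖ ^ 2 ≤ sf)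
    (hsg : ∫ y, E.piecewise (fun _ ↦ a) (fun _ ↦ b) y * ‖g y‖ ^ 2 ≤ sg) :
    |∫ y, E.piecewise (fun _ ↦ a) (fun _ ↦ b) y * (f y * conj (g y)).re| ≤ (t * sf + sg / t) / 2 := by
  set w : ℝ → ℝ := E.piecewise (fun _ ↦ a) (fun _ ↦ b) with hw
  have hwm : Measurable w := Measurable.piecewise hE measurable_const measurable_const
  have hw0 : ∀ y, 0 ≤ w y := fun y ↦ by
    by_cases hy : y ∈ E
    · rw [hw, Set.piecewise_eq_of_mem _ _ _ hy]; exact ha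
    · rw [hw, Set.piecewise_eq_of_notMem _ _ _ hy]; exact hb
  have hwC : ∀ y, |Real.sqrt (w y)| ≤ Real.sqrt (a + b) := fun y ↦ by
    rw [abs_of_nonneg (Real.sqrt_nonneg _)]
    refine Real.sqrt_le_sqrt ?_
    by_cases hy : y ∈ E
    · rw [hw, Set.piecewise_eq_of_mem _ _ _ hy]; linarith
    · rw [hw, Set.piecewise_eq_of_notMem _ _ _ hy]; linarith
  have hft : MemLp (fun y ↦ ((Real.sqrt (w y) : ℝ) : ℂ) * f y) 2 := dt_memLp_real_mul hwm.sqrt hwC hf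
  have hgt : MemLp (fun y ↦ ((Real.sqrt (w y) : ℝ) : ℂ) * g y) 2 := dt_memLp_real_mul hwm.sqrt hwC hg
  have e1 : ∫ y, ‖((Real.sqrt (w y) : ℝ) : ℂ) * f y‖ ^ 2 = ∫ y, w y * ‖f y‖ ^ 2 :=
    integral_congr_ae (Eventually.of_forall fun y ↦ dt_norm_sq_sqrt_mul (hw0 y) (f y))
  have e2 : ∫ y, ‖((Real.sqrt (w y) : ℝ) : ℂ) * g y‖ ^ 2 = ∫ y, w y * ‖g y‖ ^ 2 :=
    integral_congr_ae (Eventually.of_forall fun y ↦ dt_norm_sq_sqrt_mul (hw0 y) (g y))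
  have e3 : ∫ y, ((((Real.sqrt (w y) : ℝ) : ℂ) * f y) * conj (((Real.sqrt (w y) : ℝ) : ℂ) * g y)).re =
      ∫ y, w y * (f y * conj (g y)).re :=
    integral_congr_ae (Eventually.of_forall fun y ↦ dt_sqrt_mul_pairing_pt hw0 f g y)
  have h := dt_abs_cross_le hft hgt (sf := sf) (sg := sg) (t := t) ht (by rw [e1]; exact hsf) (by rw [e2]; exact hsg)
  rwa [e3] at h

/-- **The deflated Temple odd-sector bound from a rank-one augmented two-prime certificate, edge-only sliver.**
Hypotheses as `dt_weilOddGroundEnergy_ge_of_deflCert` (window `0 < c ≤ a₀`, `c ≤ (log 5)/2`, certificate conclusion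
`hcert23` at level `β₂₃`, trial vectors `v_i = 𝟙_{[-c,c]} · maskPoly (R_i) n a₀` with explicit window images, any `W`,
a majorant `κ₂ ≥ (log 2)/2`, `λ < β₂₃ − κ₂`), a threshold `y₁ ≤ log 4 − c`, and the WEIGHTED PSD datum `A − λG − R_w ⪰ 0` with
`w = 1/(β₂₃ − κ₂ − λ)` on `|y| ≥ y₁`, `w = 1/(β₂₃ − λ)` on `|y| < y₁`.  Conclusion: `λ ≤ ε_od(c)`. [folklore] -/
theorem dt_weilOddGroundEnergy_ge_of_deflCert_w {c : ℝ} (hc : 0 < c) (hc5 : c ≤ Real.log 5 / 2)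
    {a₀ : ℝ} (hca : c ≤ a₀) (R : List (ℚ × ℕ × List ℚ)) (n : ℕ) {β₂₃ : ℝ}
    (hRodd : ∀ i : Fin R.length, (R.get i).2.1 % 2 = 1) (hRμ : ∀ i : Fin R.length, 0 ≤ (R.get i).1)
    (hcert23 : ∀ g : ℝ → ℂ, IsWeilTest g → tsupport g ⊆ Icc (-a₀) a₀ → (∀ x, g (-x) = -g x) →
      β₂₃ * weilNorm2Sq g ≤ weilTwoPrimeQuadratic g +
        (R.map fun r ↦ (r.1 : ℝ) * ‖∑ k ∈ Finset.range n, ((maskV r k : ℚ) : ℂ) * weilMoment a₀ g k‖ ^ 2).sum)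
    (v F : Fin R.length → ℝ → ℂ)
    (hv : ∀ i x, v i x = (((Icc (-c) c).indicator (fun x ↦ maskPoly (R.get i) n a₀ x) x : ℝ) : ℂ))
    (hF : ∀ i y, F i y = (Icc (-c) c).indicator (fun y ↦
        2 * (∫ x, v i x * (Real.cosh (x / 2) : ℂ)) * (Real.cosh (y / 2) : ℂ) -
          2 * (∫ x, v i x * (Real.sinh (x / 2) : ℂ)) * (Real.sinh (y / 2) : ℂ) +
        (∑ m ∈ weilPrimeIndex c, (((ArithmeticFunction.vonMangoldt m : ℝ) / Real.sqrt m : ℝ) : ℂ) *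
          (2 * v i y - v i (y - Real.log m) - v i (y + Real.log m))) +
        ∫ t in Ioi 0, (weilArchDensity t : ℂ) * (2 * v i y - v i (y - t) - v i (y + t))) y -
      (weilMarkovConstant c : ℂ) * v i y)
    (W : Fin R.length → Fin R.length → ℝ) {κ₂ : ℝ} (hκ : Real.log 2 / 2 ≤ κ₂) {lam : ℝ} (hlam : lam < β₂₃ - κ₂)
    {y₁ : ℝ} (hy : y₁ ≤ Real.log 4 - c)
    (hPSD : ∀ α : Fin R.length → ℝ, 0 ≤ ∑ i, ∑ j, α i * α j *
      ((weilPoleForm₂ (v i) (v j) + weilDirichletEnergy₂ c (v i) (v j) -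
          weilMarkovConstant c * ∫ x, (v i x * conj (v j x)).re) - lam * (∫ x, (v i x * conj (v j x)).re) -
        ∫ y, {u : ℝ | y₁ ≤ |u|}.piecewise (fun _ ↦ 1 / (β₂₃ - κ₂ - lam)) (fun _ ↦ 1 / (β₂₃ - lam)) y *
          ((F i - ∑ l, W i l • v l) y * conj ((F j - ∑ l, W j l • v l) y)).re)) :
    lam ≤ weilOddGroundEnergy c := by
  have hE : MeasurableSet {u : ℝ | y₁ ≤ |u|} := measurableSet_le measurable_const continuous_abs.measurable
  set nE : ℝ := β₂₃ - κ₂ - lam with hnE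
  set nI : ℝ := β₂₃ - lam with hnI
  have hnE0 : 0 < nE := by rw [hnE]; linarith
  have hlog : 0 ≤ Real.log 2 / 2 := by positivity
  have hκ0 : 0 ≤ κ₂ := hlog.trans hκ
  have hnI0 : 0 < nI := by rw [hnI]; linarith
  have hnEI : nE ≤ nI := by rw [hnE, hnI]; linarith
  set C : ℝ := nI + 1 / nE with hC
  -- the weights
  have hpw : ∀ (a b : ℝ) (y : ℝ), {u : ℝ | y₁ ≤ |u|}.piecewise (fun _ ↦ a) (fun _ ↦ b) y = a ∨
      {u : ℝ | y₁ ≤ |u|}.piecewise (fun _ ↦ a) (fun _ ↦ b) y = b := by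
    intro a b y
    by_cases hy' : y ∈ {u : ℝ | y₁ ≤ |u|}
    · exact Or.inl (Set.piecewise_eq_of_mem _ _ _ hy')
    · exact Or.inr (Set.piecewise_eq_of_notMem _ _ _ hy')
  have hmeas : ∀ a b : ℝ, Measurable ({u : ℝ | y₁ ≤ |u|}.piecewise (fun _ ↦ a) (fun _ ↦ b)) := fun a b ↦
    Measurable.piecewise hE measurable_const measurable_const
  refine dt_weilOddGroundEnergy_ge_of_ritz_w hc (fun i x ↦ maskPoly (R.get i) n a₀ x)
    (fun i ↦ contDiff_maskPoly (R.get i) n a₀) (fun i x ↦ maskPoly_neg_of_odd (R.get i) (hRodd i) n a₀ x)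
    v F hv hF W (fun i ↦ ((R.get i).1 : ℝ)) lam (fun i ↦ by exact_mod_cast hRμ i)
    (n := {u : ℝ | y₁ ≤ |u|}.piecewise (fun _ ↦ nE) (fun _ ↦ nI)) (w := {u : ℝ | y₁ ≤ |u|}.piecewise (fun _ ↦ 1 / nE) (fun _ ↦ 1 / nI))
    (C := C)
    (hmeas _ _) (hmeas _ _) ?_ ?_ ?_ ?_ ?_ ?_ hPSD
  · -- |n| ≤ C
    intro y
    have h1 : 0 ≤ 1 / nE := by positivity
    rcases hpw nE nI y with h | h <;> rw [h]
    · rw [abs_of_pos hnE0, hC]; linarith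
    · rw [abs_of_pos hnI0, hC]; linarith
  · -- |w| ≤ C
    intro y
    have h1 : 1 / nI ≤ 1 / nE := one_div_le_one_div_of_le hnE0 hnEI
    rcases hpw (1 / nE) (1 / nI) y with h | h <;> rw [h]
    · rw [abs_of_pos (by positivity), hC]; linarith [hnI0.le]
    · rw [abs_of_pos (by positivity), hC]; linarith [hnI0.le]
  · intro y; rcases hpw nE nI y with h | h <;> rw [h] <;> positivity
  · intro y; rcases hpw (1 / nE) (1 / nI) y with h | h <;> rw [h] <;> positivity
  · -- w n = 1
    intro y
    by_cases hy' : y ∈ {u : ℝ | y₁ ≤ |u|}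
    · rw [Set.piecewise_eq_of_mem _ _ _ hy', Set.piecewise_eq_of_mem _ _ _ hy']; field_simp
    · rw [Set.piecewise_eq_of_notMem _ _ _ hy', Set.piecewise_eq_of_notMem _ _ _ hy']; field_simp
  · -- the weighted certificate on smooth odd tests
    intro φ hφ hφs hφo
    have hφa : tsupport φ ⊆ Icc (-a₀) a₀ := hφs.trans (Icc_subset_Icc (by linarith) hca)
    have h23 := hcert23 φ hφ hφa hφo
    have hsl := dt_weilTwoPrimeQuadratic_sub_edge_le_weilQuadratic_re hφ hφs hc5 hy
    have hsum : (R.map fun r ↦ (r.1 : ℝ) * ‖∑ k ∈ Finset.range n, ((maskV r k : ℚ) : ℂ) * weilMoment a₀ φ k‖ ^ 2).sum =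
        ∑ i : Fin R.length, ((R.get i).1 : ℝ) * ‖∫ x, φ x * conj (v i x)‖ ^ 2 := by
      rw [dt_list_sum_map_eq_sum_get]
      refine Finset.sum_congr rfl fun i _ ↦ ?_
      rw [dt_rankOne_term_eq (R.get i) n a₀ hφ hφs]
      simp only [hv i]
    have hnorm : weilNorm2Sq φ = ∫ x, ‖φ x‖ ^ 2 := rfl
    have h2 : Integrable fun u : ℝ ↦ ‖φ u‖ ^ 2 := hφ.integrable_norm_sq
    -- `∫ n|φ|² = (β₂₃ − λ)∫|φ|² − (log 2)/2 ∫ 𝟙_E |φ|²`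
    have hn_int : (∫ y, {u : ℝ | y₁ ≤ |u|}.piecewise (fun _ ↦ nE) (fun _ ↦ nI) y * ‖φ y‖ ^ 2) =
        nI * (∫ y, ‖φ y‖ ^ 2) + (nE - nI) * ∫ y, {u : ℝ | y₁ ≤ |u|}.indicator (fun u ↦ ‖φ u‖ ^ 2) y :=
      dt_integral_piecewise_mul hE nE nI h2
    have hEI : nE - nI = -κ₂ := by rw [hnE, hnI]; ring
    rw [hsum, hnorm] at h23
    rw [hn_int, hEI, hnI]
    have hX0 : 0 ≤ ∫ y, {u : ℝ | y₁ ≤ |u|}.indicator (fun u ↦ ‖φ u‖ ^ 2) y :=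
      integral_nonneg fun y ↦ Set.indicator_nonneg (fun _ _ ↦ by positivity) y
    have hκX := mul_le_mul_of_nonneg_right hκ hX0
    have : (β₂₃ - lam) * (∫ y, ‖φ y‖ ^ 2) + -κ₂ * (∫ y, {u : ℝ | y₁ ≤ |u|}.indicator (fun u ↦ ‖φ u‖ ^ 2) y) +
        lam * ∫ x, ‖φ x‖ ^ 2 = β₂₃ * (∫ y, ‖φ y‖ ^ 2) - κ₂ * ∫ y, {u : ℝ | y₁ ≤ |u|}.indicator (fun u ↦ ‖φ u‖ ^ 2) y := by
      ring
    rw [this]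
    linarith

end Summit.RiemannHypothesis.RiemannHypothesis.Theorems.EvenWinsBeyondArch

end
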